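import Literature.AnabelianGeometry.AbsoluteAnabelian.AbsCuspSeparated
import Literature.AnabelianGeometry.AbsoluteAnabelian.AbsTopIII.Cor110ProfiniteGaloisShapes
import HarnessLib

/-!
# K4 RE-CLOSE of cone node AbsTopIII:Cor1.10(iii): the [AbsCusp] Thm. 2.1 (i) composition with the separatedness
# input bound AT THE NAMED INSTANCES, and the node's Cor. 1.10 (iii) readers by name

Mochizuki, *Topics in Absolute Anabelian Geometry III*, §1, Cor. 1.10 (iii) p. 43 l. 27–30 and (f) p. 43 («(f) […] one
constructs the decomposition groups […] by applying […] [Mzk19], Theorem 2.1, (i)»); Mochizuki, *Absolute anabelian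
cuspidalizations of proper hyperbolic curves* [AbsCusp] = [Mzk19], Thm. 2.1 (i) p. 42, Prop. 2.2 (ii) p. 39, Def. 1.5 (i)
p. 31 [cite: MochizukiAbsTopIII2015, Cor 1.10 (iii) p.43] [cite: MochizukiAbsCusp2007, Thm 2.1 (i) p.42].

PROOF-ONLY sibling (abc-iut cell, block C, row «K4-COR110iii», abc-iut-L4-lead m149 (3) «GO f-052 K4-COR110iii»;
abc-iut-f-052 gen 8; K4 evidence TSV HOME/staging/f/f-052/g8/K4-f052-COR110iii.tsv).  The kernel DAG indexes the node
AbsTopIII:Cor1.10(iii) by `Summit.ABC.IUTFork.DAG.N_AbsTopIII_Cor1_10_iii := StatementOf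
@AbsCusp.thm_2_1_i_of_prop_2_2_ii ∧ StatementOf @BelyiCurveModel.isCor37Input_of_isMLF` (DAGL4p.lean).  The first closer
— the COMPOSITION BY NAME behind Cor. 1.10 (iii)(f)'s citation of [AbsCusp] Thm. 2.1 (i) for proper curves over MLF's —
binds `h22 : AbsCusp.Prop_2_2_ii_model M`, the SCHEMA form of FACT-LIST row F-0044 ([AbsCusp] Prop. 2.2 (ii): every
proper hyperbolic curve over an MLF is `𝔓𝔯𝔦𝔪𝔢𝔰`-separated), whose universal closure over models is REFUTED
(`AbsCusp.not_forall_prop_2_2_ii_model`, p-file AbsCuspSeparatedProofs) — a K4 «vacuous binder» (abc-iut-c312-2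
CONE-FACT-SURGERY row F-0044 / node AbsTopIII:Cor1.10(iii) / binder 2 `h22`).  Inside that closer `h22` is used ONLY
at the two curves `X`, `Y` of the statement (`h22 X hpX hsXs hkX`, `h22 Y hpY hsYs hkY`).  This file RE-CLOSES the
composition with the SURVIVING INSTANCE FORM of F-0044 bound at the named instances:

* `AbsCusp.thm_2_1_i_of_isSeparatedCurve` — the same conclusion `Thm_2_1_i (cuspidalizationDataOf M hX hsX)
  (cuspidalizationDataOf M hY hsY) α` from `h21 : Thm_2_1_i_model_sep M hclosed` ([AbsCusp] Thm. 2.1 (i) at the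
  printed separatedness parameter, F-0046 BY NAME) and the two FACT-INSTANCE binders
  `hsepX : IsSeparatedCurve M X`, `hsepY : IsSeparatedCurve M Y` (F-0044 AT `X` AND AT `Y`, Def. 1.5 (i)); the
  `IsScheme` binders of the schema version, used there only to feed `h22`, disappear;
* `AbsCusp.Prop_2_2_ii_model.isSeparatedCurve` — the instance extraction (the schema form implies the instance form),
  and `AbsCusp.thm_2_1_i_of_prop_2_2_ii_of_isSeparatedCurve` — the schema closer of record FACTORS through the
  re-closed one (so nothing of the node's content is lost);
* `AbsTopIII.CurveModel.cor_1_10_iii_galois_readers` — for the node's OWN statement (FACT-LIST F-0396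
  `CurveModel.Cor_1_10_iii`, decided BY NAME; printed-strength Galois-side retypes of record: tempered
  `AbsTopIII.Cor_1_10_iii_natural` p465730, profinite `AbsTopIII.CurveModel.Cor_1_10_iii_galois` p490358): the
  profinite retype delivers, at every strictly-Belyi curve of the model over an MLF, BOTH consumer shapes of the cone
  (restriction of scalars into `Aut_{ℚ_p}(k̄)`; `autCongr` along any `e : k̄ ≃ ℚ̄_p`) — a zero-LAW conjunction over the
  by-name fact, re-exporting abc-iut-f-052's `Cor110ProfiniteGaloisShapes` readers for the dag's index.

No definition, no new named fact, no instance / notation / axiom; [AbsCusp] / [AbsTopIII] facts enter BY NAME only as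
displayed hypotheses (`h21`, `hsepX`, `hsepY`, `h`).  HONEST FRAMING: re-closed ≠ discharged — the node stays a
FACT-policy node (F-0396 by name); a binder is an assumption label on OUR typed statement; typed ≠ proved; no side is
taken on [IUTchIII] Cor. 3.12; nothing here bears on the truth of abc.
-/

noncomputable section

open scoped Classical Pointwise

namespace Literature.AnabelianGeometry.AbsoluteAnabelian

universe u

namespace AbsCusp

open AbsTopIII

/-- **The instance form of F-0044 from its schema form**: `Prop_2_2_ii_model M` gives `IsSeparatedCurve M X` at every
proper scheme-like curve `X` of the model over an MLF ([AbsCusp] Prop. 2.2 (ii) p. 39 at the named instance).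
[cite: MochizukiAbsCusp2007, Prop 2.2 (ii) p.39] -/
theorem Prop_2_2_ii_model.isSeparatedCurve {M : CurveModel.{u}} (h22 : Prop_2_2_ii_model M) (X : M.Curve)
    (hp : M.IsProper X) (hs : M.IsScheme X) (hk : IsMLF (M.base X)) : IsSeparatedCurve M X :=
  h22 X hp hs hk

/-- **K4 RE-CLOSE of the [AbsCusp] Thm. 2.1 (i) composition behind [AbsTopIII] Cor. 1.10 (iii)(f)** — the conclusion of
`AbsCusp.thm_2_1_i_of_prop_2_2_ii` with the schema binder `h22 : Prop_2_2_ii_model M` (F-0044, universal closure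
refuted) REPLACED by its surviving instance form at the two named curves: `hsepX : IsSeparatedCurve M X`,
`hsepY : IsSeparatedCurve M Y` ([AbsCusp] Prop. 2.2 (ii) AT `X`, AT `Y`; Def. 1.5 (i) «`Σ`-separated»).  Granted
[AbsCusp] Thm. 2.1 (i) relative to `M` at the printed separatedness parameter (`h21`, F-0046 BY NAME), for proper
hyperbolic curves `X ⊇ U_S`, `Y ⊇ V_T` over MLF's and `α : Π_X ⥲ Π_Y` point-theoretic on closed points with `S`, `T`
corresponding, the conclusion `Thm_2_1_i` (the induced `Π_{U_S} ⥲ Π_{V_T}` data) holds — «(f) One constructs the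
decomposition groups […] [Mzk19], Theorem 2.1, (i)».  No `IsScheme` binder is needed in this form.
[cite: MochizukiAbsCusp2007, Thm 2.1 (i) p.42] -/
theorem thm_2_1_i_of_isSeparatedCurve (M : CurveModel.{u})
    {hclosed : ∀ (U : M.Curve) (x : M.Point U), IsClosed (M.decomp U x : Set (M.ext U).arith)}
    (h21 : Thm_2_1_i_model_sep M hclosed)
    {US X VT Y : M.Curve} (hX : M.IsCofiniteOpen US X) (hY : M.IsCofiniteOpen VT Y)
    (hsX : Function.Surjective (M.res hX).arith) (hsY : Function.Surjective (M.res hY).arith)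
    (hpX : M.IsProper X) (hpY : M.IsProper Y) (hkX : IsMLF (M.base X)) (hkY : IsMLF (M.base Y))
    (hsepX : IsSeparatedCurve M X) (hsepY : IsSeparatedCurve M Y)
    (α : (M.ext X).arith ≃ₜ* (M.ext Y).arith)
    (hpt : (fun D : Subgroup (M.ext X).arith => D.map α.toMonoidHom) ''
        (GalSect.pointDataOf M X (hclosed X)).decompositionGroups =
      (GalSect.pointDataOf M Y (hclosed Y)).decompositionGroups)
    (hST : ∀ c : (M.cusps US).Cusp, ∃ (d : (M.cusps VT).Cusp) (g : (M.ext Y).arith),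
        (((M.cusps US).Dcusp c).map (M.res hX).arith.toMonoidHom).map α.toMonoidHom =
          MulAut.conj g • ((M.cusps VT).Dcusp d).map (M.res hY).arith.toMonoidHom)
    (hTS : ∀ d : (M.cusps VT).Cusp, ∃ (c : (M.cusps US).Cusp) (g : (M.ext Y).arith),
        (((M.cusps US).Dcusp c).map (M.res hX).arith.toMonoidHom).map α.toMonoidHom =
          MulAut.conj g • ((M.cusps VT).Dcusp d).map (M.res hY).arith.toMonoidHom) :
    Thm_2_1_i (cuspidalizationDataOf M hX hsX) (cuspidalizationDataOf M hY hsY) α :=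
  h21 US X VT Y hX hY hsX hsY hpX hpY hkX hkY hsepX hsepY α hpt hST hTS

/-- The schema closer of record FACTORS through the re-closed one: `thm_2_1_i_of_prop_2_2_ii` is
`thm_2_1_i_of_isSeparatedCurve` fed with the two instances extracted from `h22` (so the node's indexed content is
unchanged by the re-close). [cite: MochizukiAbsCusp2007, Thm 2.1 (i) p.42] -/
theorem thm_2_1_i_of_prop_2_2_ii_of_isSeparatedCurve (M : CurveModel.{u})
    {hclosed : ∀ (U : M.Curve) (x : M.Point U), IsClosed (M.decomp U x : Set (M.ext U).arith)}
    (h22 : Prop_2_2_ii_model M) (h21 : Thm_2_1_i_model_sep M hclosed)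
    {US X VT Y : M.Curve} (hX : M.IsCofiniteOpen US X) (hY : M.IsCofiniteOpen VT Y)
    (hsX : Function.Surjective (M.res hX).arith) (hsY : Function.Surjective (M.res hY).arith)
    (hpX : M.IsProper X) (hpY : M.IsProper Y) (hsXs : M.IsScheme X) (hsYs : M.IsScheme Y)
    (hkX : IsMLF (M.base X)) (hkY : IsMLF (M.base Y))
    (α : (M.ext X).arith ≃ₜ* (M.ext Y).arith)
    (hpt : (fun D : Subgroup (M.ext X).arith => D.map α.toMonoidHom) ''
        (GalSect.pointDataOf M X (hclosed X)).decompositionGroups =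
      (GalSect.pointDataOf M Y (hclosed Y)).decompositionGroups)
    (hST : ∀ c : (M.cusps US).Cusp, ∃ (d : (M.cusps VT).Cusp) (g : (M.ext Y).arith),
        (((M.cusps US).Dcusp c).map (M.res hX).arith.toMonoidHom).map α.toMonoidHom =
          MulAut.conj g • ((M.cusps VT).Dcusp d).map (M.res hY).arith.toMonoidHom)
    (hTS : ∀ d : (M.cusps VT).Cusp, ∃ (c : (M.cusps US).Cusp) (g : (M.ext Y).arith),
        (((M.cusps US).Dcusp c).map (M.res hX).arith.toMonoidHom).map α.toMonoidHom =
          MulAut.conj g • ((M.cusps VT).Dcusp d).map (M.res hY).arith.toMonoidHom) :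
    Thm_2_1_i (cuspidalizationDataOf M hX hsX) (cuspidalizationDataOf M hY hsY) α :=
  thm_2_1_i_of_isSeparatedCurve M h21 hX hY hsX hsY hpX hpY hkX hkY
    (h22.isSeparatedCurve X hpX hsXs hkX) (h22.isSeparatedCurve Y hpY hsYs hkY) α hpt hST hTS

end AbsCusp

namespace AbsTopIII.CurveModel

open Field Literature.NumberTheory.GaloisRepresentations FundamentalExtension

/-- **The node's own statement, read BY NAME** (zero LAW, one by-name FACT binder): the printed-strength profinite
Galois-side retype `CurveModel.Cor_1_10_iii_galois M` of [AbsTopIII] Cor. 1.10 (iii) (FACT-LIST F-0396 retyped,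
p490358) delivers at every curve `X` of the model of strictly Belyi type over an MLF (`ℚ_p ⊆ k` finite) BOTH consumer
shapes of the abc-iut cone — for every topological automorphism `α` of `Π_X`: (res) some `τ ∈ Aut_{ℚ_p}(k̄)` with
`res(galIso(aug(α x))) = τ · res(galIso(aug x)) · τ⁻¹`, and (aut) for any displayed `e : k̄ ≃ ℚ̄_p` some
`τ ∈ Aut_{ℚ_p}(ℚ̄_p) = G_{ℚ_p}` with `e.autCongr(…) = τ · e.autCongr(…) · τ⁻¹` — the readers of abc-iut-f-052's
`Cor110ProfiniteGaloisShapes` (p490763) conjoined for the kernel DAG index of node AbsTopIII:Cor1.10(iii).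
[cite: MochizukiAbsTopIII2015, Cor 1.10 (iii) p.43] -/
theorem cor_1_10_iii_galois_readers {M : CurveModel.{u}} (h : M.Cor_1_10_iii_galois) (X : M.Curve) (p : ℕ)
    [Fact p.Prime] [Algebra ℚ_[p] (M.base X)] [FiniteDimensional ℚ_[p] (M.base X)] (hX : M.IsStrictlyBelyiType X) :
    (M.mlfBase X p).ProfiniteHGal ∧
      ∀ e : AlgebraicClosure (M.base X) ≃ₐ[ℚ_[p]] AlgebraicClosure ℚ_[p],
        (M.ext X).AutLiesOverInner ((M.mlfBase X p).toGQp e) :=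
  ⟨(profiniteAutOverGQp_iff_profiniteHGal (M.mlfBase X p)).mp (h.profiniteAutOverGQp X p hX),
    fun e => (profiniteAutOverGQp_iff_autLiesOverInner_toGQp (M.mlfBase X p) e).mp (h.profiniteAutOverGQp X p hX)⟩

end AbsTopIII.CurveModel

end Literature.AnabelianGeometry.AbsoluteAnabelian
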